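/-
Copyright (c) 2026 the pub-hodgecm-mathlib formalisation cell (harness21).  Prover seat hodgecm-mathlib-F0P2-p01 (g15), 2026-09-01.  «S3-ram» seeding wave (LEAD F0P3a-plan (g12)
T11-41; owner∕desk F0P3a-p06 (g15); END F0P3a-p03 (g16) word 21:58:42Z): row «(U)-ram TWO-LAYER HEAD», FILE B — the BOUNDARY VALUE (layer 1) at a tame-ramified place.
-/
import Literature.NumberTheory.Rogawski1990.LevelTwoPieceBoundaryValues                      -- ★ inert organ V (BD-half): adapters `isIntMatrix_smul_conj_sub_one{,_sq}`, `mem_glInt_iff_isIntMatrix`, ROW-0 bridge, rank dictionary, `antidiagOne_eq_over`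
import Literature.NumberTheory.Automorphic.UnitaryThreeBoundaryRigidityLevelTwoRamifiedRegular -- ★ RIGID-2-ram p846886 (B-p14 (g37)): `levelTwo_conj_upperUnipotent_one_of_two_deep_of_neg`
import Literature.NumberTheory.Rogawski1990.UnitFundamentalLemmaFrameOfFormCongr              -- ★ p846897 (F0P3a-p04 (g17)): the frame `e g = A g_w A⁻¹` from the binder `hframe`, `K′ ↔ GL₃(𝒪_w)`
import Literature.NumberTheory.Automorphic.RamifiedPlaceAntiFixedUniformizer                   -- ★ `valued_toPlace_uniformizer_of_ramified` (`|ι_v ϖ_v|_w = exp(−2)`)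
import Literature.NumberTheory.Automorphic.Liu2021.LemD1AsPrintedIndexedNonVacuityRamifiedConverse -- ★ `valued_galAdicCompletionMap_sub_lt_one_of_ramified` (`σ_w ≡ id (mod 𝔪_w)`)
import HarnessLib

/-!
# A `v`-level-1 `K`-class piece at a TAME-RAMIFIED non-split place: the boundary value (layer 1 of the two-layer strata, Rogawski 1990 §3.9 ∕ §4.9)

Topic `NumberTheory/Rogawski1990`; namespace `Literature.NumberTheory.Rogawski1990`.  THEOREMS ONLY (no definition, no instance, no notation, no named fact, no `sorry`).
Cell `pub/hodgecm-mathlib` (D-0151), crux H413 = `stmt-HodgeConjecture-24833`; road «S3-ram» (Literature seeding, LEAD F0P3a-plan (g12) T11-41∕T11-50 (2); owner F0P3a-p06 (g15)),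
row «(U)-ram TWO-LAYER HEAD» (END F0P3a-p03 (g16) 21:46:46Z∕21:58:42Z: the internal strata organ of the rows socket `stub_levelOneRowsRam` :118 of the fold
`LocalTransferAtOneTameRamified` v6), FILE B of three (A: the finite `𝔭`-layer, B: this boundary value, C: the interior layer and the head).

SETTING.  `L∕L⁺` CM, `v` a finite place of `L⁺` NON-SPLIT and TAMELY RAMIFIED in `L` (`w ∣ v`, `σ_w w = w`, `e(w|v) ≠ 1`, `2 ∈ 𝒪_w^×`), `H′` hermitian with an INTEGRAL ANTIDIAGONAL
FRAME `H′_w = (−det H′_w) • ᵗ(σ_w A) J₀ A`, `A ∈ GL₃(𝒪_w)` (the fold's binders `(A hA hframe)`, ★ p846344), `G′_v = U(H′)(L⁺_v)`, `K = K′ = U(H′)(𝒪_v)`.  A *`v`-level-1 `K`-class piece*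
is a function `g` on `G′_v` that is `Ad K`-invariant and LEFT-invariant under `K(ϖ_v) = {u ∈ K : u_w ≡ 1 (ϖ_v)}` (the fold's token `(toPlace v w ϖ_v) ^ 1`; at a ramified `w`,
`|ϖ_v|_w = exp(−2)`, so `K(ϖ_v) = K_w(2)` and `K ⧸ K(ϖ_v) = O₃(𝔽_q) ⋉ 𝔭` has TWO residual layers).

THE MATHEMATICS (layer 1 = the BOUNDARY `red(k_w) ≠ 1`).  Unlike the `w`-level-1 organ ★ p846857 (`strataConstancy_of_levelOne_ramified`, whose piece is left-`K_w(1)`-invariant), a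
`v`-level-1 piece is NOT constant on the whole residually-regular-unipotent stratum of `K` (the `Ad K`-classes of `K ⧸ K_w(2)` over a regular unipotent `ū ∈ O₃(𝔽_q)` form a
2-parameter family); it IS constant on the part of that stratum lying in `v`-DEEP CLASSES — `x ∈ K` with `red(x_w) − 1` of rank `2` and `y x y⁻¹ ≡ 1 (mod ϖ_v)` for some `y ∈ G′_v`
— by RIGID-2-ram ★ p846886 (`levelTwo_conj_upperUnipotent_one_of_two_deep_of_neg`, B-p14 (g37), certificate «S3-ram (iv)»): through the frame `e z = A z_w A⁻¹` such an `x` is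
`K`-conjugate modulo `ϖ_w² 𝔤(𝒪_w) = ϖ_v 𝔤(𝒪_w)` to the reference `u(1, 1, b₀)`, `b₀ = −½`.  The rank-`1` boundary stratum is EMPTY at a ramified `w` (no transvections in `O₃`, ★ p846855 ∕
★ p846826), so layer 1 carries ONE value.  This file is the tame-ramified twin of the inert organ-V BD-half ★ `LevelTwoPieceBoundaryValues` ONE `v`-level down (`K(2) ↦ K(ϖ_v)`,
`hv ↦ he`, the good-reduction frame ↦ the frame of the binder `hframe` ★ p846897, RIGID-2 ↦ RIGID-2-ram).

* §1 `apply_eq_of_conj_eq_level_mul` — pull-back of a factorisation `k (e x) k⁻¹ = u · (e z)` (`k ∈ U(σ_w,J₀) ∩ GL₃(𝒪_w)`, `u ≡ 1` at level `c`) along a frame: `g x = g z` (any level scalar `c`;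
  the inert ★ `apply_eq_of_conj_eq_levelTwo_mul` is `c = ϖ_v⁻²`).
* §2 `exists_conj_eq_levelTwo_mul_upperUnipotent_one_of_ramified` — RIGID-2-ram in «unit-factor» form: `k x k⁻¹ = u · u(1,1,b₀)`, `u ≡ 1 (mod ϖ²)` (generic valued field, residually
  trivial isometric involution; the twin of ★ `exists_conj_eq_levelTwo_mul_upperUnipotent_one_of_two_deep`).
* §3 `apply_eq_of_levelDeep_of_rank_redMat_sub_one_eq_two_ramified` — THE HEART: `g x = g (e⁻¹ u(1,1,b₀))` for `x ∈ K` residually regular unipotent lying in a `v`-deep class.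
* §4 `exists_boundaryValue_of_levelOne_ramified` — row (R1) of the two-layer head in the fold's tokens: `∃ c : ℕ → ℂ, c 0 = 0 ∧ ∀ x ∈ K, (red x_w − 1)³ = 0 → rank(red x_w − 1) = 2 →
  (∃ y, y x y⁻¹ ≡ 1 (mod ϖ_v)) → g x = c 2`.

HONEST LABEL: HC_CM is proved only modulo the 2 remaining named inputs (hLiu418 24832, h413 24833) until rung 0 closes; «S3-ram» is Literature seeding with no books consequence;
this file is unconditional local algebra and discharges nothing by itself.

## References
* [Rogawski1990] J. D. Rogawski, *Automorphic Representations of Unitary Groups in Three Variables*, Ann. of Math. Stud. 123 (1990): §3.9 p. 32, Prop. 3.9.1; §4.9 p. 54.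
* [Tits1979] J. Tits, *Reductive groups over local fields*, PSPM 33.1 (1979): §3.3.3, §3.5 (congruence filtration of special parahorics).
* [Kottwitz1986] R. E. Kottwitz, *Base change for unit elements of Hecke algebras*, Compositio Math. 60 (1986): §3.
-/

set_option autoImplicit false

noncomputable section

open NumberField IsDedekindDomain Matrix ValuativeRel
open Literature.NumberTheory.Automorphic Literature.NumberTheory.GaloisRepresentations Literature.NumberTheory.Automorphic.UnitaryGroup
open Literature.NumberTheory.Automorphic.IntegralReduction Literature.GroupTheory.SpecificGroups
open Literature.NumberTheory.Automorphic.HermitianLattice Literature.NumberTheory.Automorphic.UnitaryLatticeTree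
open scoped Matrix MatrixGroups ValuativeRel WithZero

namespace Literature.NumberTheory.Rogawski1990

open Literature.NumberTheory.Automorphic.Liu2021.LemD1IndexedNonVacuityRamifiedConverse (valued_galAdicCompletionMap_sub_lt_one_of_ramified)

/-! ## §1 Pull-back of a unit factorisation along a frame (any level scalar) -/

section PullBack

set_option maxHeartbeats 800000 in
-- budget only: one statement-heavy declaration (the CM-place tokens); no search tactic runs long here.
/-- **Pull-back of a level-`c` unit factorisation along a frame.**  In a frame `e : G′_v ≃ U(σ_w, Φ₃)(L_w)` with `(e z) = T z_w T⁻¹`, `T ∈ GL₃(𝒪_w)`, `K ↔ GL₃(𝒪_w)`: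
if `k (e x) k⁻¹ = u · (e z_T)` with `k ∈ U(σ_w,J₀) ∩ GL₃(𝒪_w)`, `u ∈ U(σ_w,J₀)`, `c • (u − 1)` integral, then `g x = g z_T` for every `Ad K`-invariant `g` that is left-invariant
under `{u′ : c·((u′)_w − 1) integral}` — `k′ := e⁻¹ k ∈ K`, `u′ := e⁻¹ u` (congruences transported by ★ `isIntMatrix_smul_conj_sub_one`), `g x = g(k′xk′⁻¹) = g(u′ z_T) = g z_T`.
The inert ★ `apply_eq_of_conj_eq_levelTwo_mul` is the case `c = ϖ_v⁻²`; the ramified head below uses `c = ϖ_v⁻¹`. [cite: Rogawski1990, §4.9 p. 54] [cite: Tits1979, §3.5] -/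
theorem apply_eq_of_conj_eq_level_mul
    (L : Type) [Field L] [NumberField L] [IsCMField L] (H' : Matrix (Fin 3) (Fin 3) L)
    {v : HeightOneSpectrum (𝓞 ↥(maximalRealSubfield L))}
    (w : PlacesOver L v) (hw : IsCMField.complexConj L • w.1 = w.1) (c : w.1.adicCompletion L)
    (g : ((cmDatum L 3 H').Local v) → ℂ)
    (hginv : ∀ u ∈ (cmLocalIntegralLevel L 3 H' v), ∀ x, g (u * x * u⁻¹) = g x)
    (hgc : ∀ u : ((cmDatum L 3 H').Local v),
      (∀ a b, Valued.v (c * (((((localNonsplitEquiv (IsCMField.complexConj L) H' (IsCMField.complexConj_ne_one L) w hw u) : ↥(unitaryGroupOfForm (galAdicCompletionMap (L := L) (IsCMField.complexConj L) hw) (placeForm H' w.1))) : GL (Fin 3) (w.1.adicCompletion L)) : Matrix (Fin 3) (Fin 3) (w.1.adicCompletion L)) a b - (1 : Matrix (Fin 3) (Fin 3) (w.1.adicCompletion L)) a b)) ≤ 1) →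
      ∀ x, g (u * x) = g x)
    (T : GL (Fin 3) (w.1.adicCompletion L)) (hT : T ∈ glInt 3 (w.1.adicCompletion L))
    (e : ↥(UnitaryGroup.«local» L (IsCMField.complexConj L) 3 H' v) ≃ₜ* ↥(unitaryGroupOfForm (galAdicCompletionMap (L := L) (IsCMField.complexConj L) hw) (placeForm (Matrix.of fun i j : Fin 3 => if i.val + j.val + 1 = 3 then (1 : L) else 0) w.1)))
    (he : ∀ z, ((e z).val : GL (Fin 3) (w.1.adicCompletion L)) = T * (((localNonsplitEquiv (IsCMField.complexConj L) H' (IsCMField.complexConj_ne_one L) w hw z)).val : GL (Fin 3) (w.1.adicCompletion L)) * T⁻¹)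
    (hKe : ∀ z, z ∈ cmLocalIntegralLevel L 3 H' v ↔ ((e z).val : GL (Fin 3) (w.1.adicCompletion L)) ∈ glInt 3 (w.1.adicCompletion L))
    {x zT : ((cmDatum L 3 H').Local v)} {k u : GL (Fin 3) (w.1.adicCompletion L)} (hkU : k ∈ (unitaryGroupOfForm (galAdicCompletionMap (L := L) (IsCMField.complexConj L) hw) ((StdForm.antidiagonal 3).over (w.1.adicCompletion L)))) (hki : IsIntMatrix (k : Matrix (Fin 3) (Fin 3) (w.1.adicCompletion L))) (hki' : IsIntMatrix ((k⁻¹ : GL (Fin 3) (w.1.adicCompletion L)) : Matrix (Fin 3) (Fin 3) (w.1.adicCompletion L)))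
    (huU : u ∈ (unitaryGroupOfForm (galAdicCompletionMap (L := L) (IsCMField.complexConj L) hw) ((StdForm.antidiagonal 3).over (w.1.adicCompletion L)))) (hu2 : IsIntMatrix (c • ((u : Matrix (Fin 3) (Fin 3) (w.1.adicCompletion L)) - 1)))
    (hkxk : k * ((e x).val : GL (Fin 3) (w.1.adicCompletion L)) * k⁻¹ = u * ((e zT).val : GL (Fin 3) (w.1.adicCompletion L))) : g x = g zT := by
  classical
  have hJw : placeForm (Matrix.of fun i j : Fin 3 => if i.val + j.val + 1 = 3 then (1 : L) else 0) w.1 = ((StdForm.antidiagonal 3).over (w.1.adicCompletion L)) := by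
    rw [placeForm, antidiagOne_eq_over, StdForm.over_map]
  have hU' : ∀ {X : GL (Fin 3) (w.1.adicCompletion L)}, X ∈ (unitaryGroupOfForm (galAdicCompletionMap (L := L) (IsCMField.complexConj L) hw) ((StdForm.antidiagonal 3).over (w.1.adicCompletion L))) → X ∈ (unitaryGroupOfForm (galAdicCompletionMap (L := L) (IsCMField.complexConj L) hw) (placeForm (Matrix.of fun i j : Fin 3 => if i.val + j.val + 1 = 3 then (1 : L) else 0) w.1)) := fun {X} hX => by
    rw [hJw]; exact hX
  have hTi : IsIntMatrix (T : Matrix (Fin 3) (Fin 3) (w.1.adicCompletion L)) := ((mem_glInt_iff_isIntMatrix L 3 w T).1 hT).1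
  have hTi' : IsIntMatrix ((T⁻¹ : GL (Fin 3) (w.1.adicCompletion L)) : Matrix (Fin 3) (Fin 3) (w.1.adicCompletion L)) := ((mem_glInt_iff_isIntMatrix L 3 w T).1 hT).2
  have hT'T : ((T⁻¹ : GL (Fin 3) (w.1.adicCompletion L)) : Matrix (Fin 3) (Fin 3) (w.1.adicCompletion L)) * (T : Matrix (Fin 3) (Fin 3) (w.1.adicCompletion L)) = 1 := by rw [← Units.val_mul, inv_mul_cancel, Units.val_one]
  obtain ⟨k', hk'⟩ : ∃ k' : ((cmDatum L 3 H').Local v), k' = e.symm ⟨k, hU' hkU⟩ := ⟨_, rfl⟩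
  obtain ⟨u', hu'⟩ : ∃ u' : ((cmDatum L 3 H').Local v), u' = e.symm ⟨u, hU' huU⟩ := ⟨_, rfl⟩
  have hek' : e k' = ⟨k, hU' hkU⟩ := by rw [hk']; exact e.apply_symm_apply _
  have heu' : e u' = ⟨u, hU' huU⟩ := by rw [hu']; exact e.apply_symm_apply _
  have hek'v : ((e k').val : GL (Fin 3) (w.1.adicCompletion L)) = k := by rw [hek']
  have heu'v : ((e u').val : GL (Fin 3) (w.1.adicCompletion L)) = u := by rw [heu']
  have hk'K : k' ∈ (cmLocalIntegralLevel L 3 H' v) :=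
    (hKe k').2 (by rw [hek'v]; exact (mem_glInt_iff_isIntMatrix L 3 w k).2 ⟨hki, hki'⟩)
  -- `k′ x k′⁻¹ = u′ z_T`, read in `U(σ_w, J₀)`
  have hm1 : e (k' * x * k'⁻¹) = e (k' * x) * e k'⁻¹ := map_mul e _ _
  have hm2 : e (k' * x) = e k' * e x := map_mul e _ _
  have hm3 : e k'⁻¹ = (e k')⁻¹ := map_inv e _
  have hm4 : e (u' * zT) = e u' * e zT := map_mul e _ _
  have hprod : k' * x * k'⁻¹ = u' * zT := by
    apply e.injective
    rw [hm1, hm2, hm3, hm4]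
    apply Subtype.ext
    show ((e k').val : GL (Fin 3) (w.1.adicCompletion L)) * (e x).val * ((e k').val)⁻¹ = (e u').val * (e zT).val
    rw [hek'v, heu'v]
    exact hkxk
  -- `u′` at level `c`: the `hgc` token
  have hU₀ : (((localNonsplitEquiv (IsCMField.complexConj L) H' (IsCMField.complexConj_ne_one L) w hw u')).val : GL (Fin 3) (w.1.adicCompletion L)) = T⁻¹ * u * T := by
    have h := he u'
    rw [heu'v] at h
    rw [h]; group
  have hu'2 : IsIntMatrix (c • ((((((localNonsplitEquiv (IsCMField.complexConj L) H' (IsCMField.complexConj_ne_one L) w hw u')).val : GL (Fin 3) (w.1.adicCompletion L)) : Matrix (Fin 3) (Fin 3) (w.1.adicCompletion L))) - 1)) := by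
    have h := isIntMatrix_smul_conj_sub_one c hTi' hTi hT'T hu2
    have hm : ((((localNonsplitEquiv (IsCMField.complexConj L) H' (IsCMField.complexConj_ne_one L) w hw u')).val : GL (Fin 3) (w.1.adicCompletion L)) : Matrix (Fin 3) (Fin 3) (w.1.adicCompletion L)) = ((T⁻¹ : GL (Fin 3) (w.1.adicCompletion L)) : Matrix (Fin 3) (Fin 3) (w.1.adicCompletion L)) * (u : Matrix (Fin 3) (Fin 3) (w.1.adicCompletion L)) * (T : Matrix (Fin 3) (Fin 3) (w.1.adicCompletion L)) := by
      rw [hU₀]; simp only [Units.val_mul]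
    rw [hm]; exact h
  have hu'tok : (∀ a b, Valued.v (c * (((((localNonsplitEquiv (IsCMField.complexConj L) H' (IsCMField.complexConj_ne_one L) w hw u') : ↥(unitaryGroupOfForm (galAdicCompletionMap (L := L) (IsCMField.complexConj L) hw) (placeForm H' w.1))) : GL (Fin 3) (w.1.adicCompletion L)) : Matrix (Fin 3) (Fin 3) (w.1.adicCompletion L)) a b - (1 : Matrix (Fin 3) (Fin 3) (w.1.adicCompletion L)) a b)) ≤ 1) := fun a b => by
    have h := hu'2 a b
    simp only [Matrix.smul_apply, Matrix.sub_apply, smul_eq_mul] at h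
    exact h
  calc g x = g (k' * x * k'⁻¹) := (hginv k' hk'K x).symm
    _ = g (u' * zT) := by rw [hprod]
    _ = g zT := hgc u' hu'tok zT

end PullBack

/-! ## §2 RIGID-2-ram in unit-factor form (generic valued field, residually trivial isometric involution) -/

section UnitFactor

variable {K : Type*} [Field K] [Valued K ℤᵐ⁰]

/-- **RIGID-2-ram, REGULAR TYPE (= the whole boundary at a ramified place), in «unit-factor» form**: under the hypotheses of ★ `levelTwo_conj_upperUnipotent_one_of_two_deep_of_neg`
(`σ` an isometric involution, residually trivial, `ϖ` any uniformiser, `|2| = 1`; `x = g⁻¹γg` integral with `γ ≡ 1 (mod ϖ²)` and `x ≢ 1 (mod ϖ)`), `k x k⁻¹ = u · m` with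
`(m : M₃) = u(1, 1, b₀)`, `k ∈ U(σ, J₀) ∩ GL₃(𝒪)`, `u ∈ U(σ, J₀)`, `u ≡ 1 (mod ϖ²)` — the congruence of ★ p846886 repackaged as in ★ `exists_conj_eq_levelTwo_mul_upperUnipotent_one_of_two_deep`
(★ `isIntMatrix_smul_mul_inv_sub_one`). [cite: Rogawski1990, §3.9 Prop. 3.9.1 p. 32] [cite: Tits1979, §3.3.3, §3.5] -/
theorem exists_conj_eq_levelTwo_mul_upperUnipotent_one_of_ramified [ValuativeRel K] [(Valued.v : Valuation K ℤᵐ⁰).Compatible]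
    {σ : K →+* K} {ϖ : K} (hσ : ∀ x, σ (σ x) = x) (hvσ : ∀ a, Valued.v (σ a) = Valued.v a)
    (hϖ : Valued.v ϖ = WithZero.exp (-1 : ℤ)) (hres : ∀ x : K, Valued.v x ≤ 1 → Valued.v (σ x - x) < 1) (h2 : Valued.v (2 : K) = 1)
    {γ g x : GL (Fin 3) K} (hγU : γ ∈ unitaryGroupOfForm σ ((StdForm.antidiagonal 3).over K))
    (hγ2 : IsIntMatrix ((ϖ ^ 2)⁻¹ • ((γ : Matrix (Fin 3) (Fin 3) K) - 1)))
    (hgU : g ∈ unitaryGroupOfForm σ ((StdForm.antidiagonal 3).over K)) (hxg : x = g⁻¹ * γ * g) (hxint : IsIntMatrix (x : Matrix (Fin 3) (Fin 3) K))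
    (hx0 : ¬ IsIntMatrix (ϖ⁻¹ • ((x : Matrix (Fin 3) (Fin 3) K) - 1)))
    {b₀ : K} (hb₀ : b₀ + σ b₀ + 1 = 0) (hb₀v : Valued.v b₀ ≤ 1) :
    ∃ k m u : GL (Fin 3) K, k ∈ unitaryGroupOfForm σ ((StdForm.antidiagonal 3).over K) ∧ IsIntMatrix (k : Matrix (Fin 3) (Fin 3) K) ∧
      IsIntMatrix ((k⁻¹ : GL (Fin 3) K) : Matrix (Fin 3) (Fin 3) K) ∧
      (m : Matrix (Fin 3) (Fin 3) K) = !![1, 1, b₀; 0, 1, -1; 0, 0, 1] ∧ m ∈ unitaryGroupOfForm σ ((StdForm.antidiagonal 3).over K) ∧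
      IsIntMatrix (m : Matrix (Fin 3) (Fin 3) K) ∧ IsIntMatrix ((m⁻¹ : GL (Fin 3) K) : Matrix (Fin 3) (Fin 3) K) ∧
      u ∈ unitaryGroupOfForm σ ((StdForm.antidiagonal 3).over K) ∧
      IsIntMatrix ((ϖ ^ 2)⁻¹ • ((u : Matrix (Fin 3) (Fin 3) K) - 1)) ∧ k * x * k⁻¹ = u * m := by
  obtain ⟨k, hkU, hki, hki', hk⟩ := levelTwo_conj_upperUnipotent_one_of_two_deep_of_neg hσ hvσ hϖ hres h2 hγU hγ2 hgU hxg hxint hx0 hb₀ hb₀v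
  obtain ⟨m, hm, hm'⟩ := exists_units_coe_eq_upperTriangularUnipotent (1 : K) b₀ (-1)
  have hmU : m ∈ unitaryGroupOfForm σ ((StdForm.antidiagonal 3).over K) := by
    refine (mem_unitaryGroupOfForm_iff_of_coe_eq_upperUnipotent σ hσ hm).2 ⟨by rw [map_one], ?_⟩
    rw [map_one, mul_one]; exact hb₀
  have h1v : Valued.v (1 : K) ≤ 1 := by rw [map_one]
  have hn1v : Valued.v (-1 : K) ≤ 1 := by rw [Valuation.map_neg, map_one]
  have hmi : IsIntMatrix (m : Matrix (Fin 3) (Fin 3) K) := by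
    rw [hm]; exact isIntMatrix_upperUnipotent h1v hb₀v hn1v
  have hmi' : IsIntMatrix ((m⁻¹ : GL (Fin 3) K) : Matrix (Fin 3) (Fin 3) K) := by
    rw [hm']
    refine isIntMatrix_upperUnipotent hn1v ?_ (by rw [neg_neg, map_one])
    calc Valued.v ((1 : K) * -1 - b₀) = Valued.v (-(1 + b₀)) := by ring_nf
      _ ≤ 1 := by rw [Valuation.map_neg]; exact Valuation.map_add_le _ h1v hb₀v
  have hxU : x ∈ unitaryGroupOfForm σ ((StdForm.antidiagonal 3).over K) := by
    rw [hxg]; exact mul_mem (mul_mem (inv_mem hgU) hγU) hgU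
  refine ⟨k, m, k * x * k⁻¹ * m⁻¹, hkU, hki, hki', hm, hmU, hmi, hmi', ?_, ?_, ?_⟩
  · exact mul_mem (mul_mem (mul_mem hkU hxU) (inv_mem hkU)) (inv_mem hmU)
  · rw [← hm] at hk
    exact isIntMatrix_smul_mul_inv_sub_one ((ϖ ^ 2)⁻¹) hmi' hk
  · rw [inv_mul_cancel_right]

/-- Level bookkeeping: if `|a| = |b|` then `a⁻¹ • M` is integral iff `b⁻¹ • M` is. [cite: Tits1979, §3.5] -/
theorem isIntMatrix_inv_smul_iff_of_v_eq {N : ℕ} {a b : K} (hab : Valued.v a = Valued.v b) (ha : a ≠ 0) (M : Matrix (Fin N) (Fin N) K) :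
    IsIntMatrix (a⁻¹ • M) ↔ IsIntMatrix (b⁻¹ • M) := by
  have hb : b ≠ 0 := fun h => by
    rw [h, map_zero] at hab; exact ha ((Valuation.zero_iff _).1 hab)
  rw [UnitaryGroup.isIntMatrix_inv_smul_iff ha, UnitaryGroup.isIntMatrix_inv_smul_iff hb, hab]

end UnitFactor

/-! ## §3 The heart: the boundary value of a `v`-level-1 piece at a tame-ramified place -/

section Heart

set_option maxHeartbeats 800000 in
-- budget only: one statement-heavy declaration (the CM-place tokens); no search tactic runs long here.
/-- **THE HEART — the value of a `v`-level-1 `K`-class piece at a residually REGULAR unipotent `x ∈ K` that is `G′_v`-conjugate into `K(ϖ_v)` is `g (e⁻¹ u(1,1,b₀))`.**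
TAME-RAMIFIED non-split `w` (`he`, `h2`), `ϖ` a uniformiser of `L_w` (the fold's block binder; `σϖ = −ϖ` is not used), a frame `e` with `(e z) = T z_w T⁻¹`, `T ∈ GL₃(𝒪_w)`,
`K ↔ GL₃(𝒪_w)`.  The `v`-deep conjugate `γ = y x y⁻¹` (`γ_w ≡ 1 (mod ϖ_v) = (mod ϖ_w²)`, `|ι_v ϖ_v|_w = exp(−2)` ★ `valued_toPlace_uniformizer_of_ramified`) makes RIGID-2-ram applicable to
`e x = (e y)⁻¹ (e γ) (e y)` (§2: `k (e x) k⁻¹ = u · m`, `u ≡ 1 (mod ϖ_w²)`; `σ_w ≡ id (mod 𝔪_w)` ★ `valued_galAdicCompletionMap_sub_lt_one_of_ramified`); pulled back along `e` (§1,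
`c = ϖ_v⁻¹`), `g x = g(u′ · e⁻¹m) = g(e⁻¹ m)`.  Only the residual rank `2` of `red x_w − 1` is used (no nilpotency hypothesis: RIGID-2-ram needs depth `0` only), read as «`x_w ≢ 1 (mod ϖ_w)`» by the ROW-0 bridge
★ `rank_redMat_sub_one_eq_zero_iff_forall_valuation_le` (any uniformising element).  Twin of ★ `apply_eq_of_two_deep_of_rank_redMat_sub_one` (rank-`2` branch) one `v`-level down.
[cite: Rogawski1990, §3.9 p. 32, Prop. 3.9.1; §4.9 p. 54] [cite: Tits1979, §3.5] [cite: Kottwitz1986, §3] -/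
theorem apply_eq_of_levelDeep_of_rank_redMat_sub_one_eq_two_ramified
    (L : Type) [Field L] [NumberField L] [IsCMField L] (H' : Matrix (Fin 3) (Fin 3) L)
    {v : HeightOneSpectrum (𝓞 ↥(maximalRealSubfield L))}
    (w : PlacesOver L v) (hw : IsCMField.complexConj L • w.1 = w.1) (he : v.asIdeal.ramificationIdx' w.1.asIdeal ≠ 1)
    (h2 : IsUnit (2 : 𝒪[(w.1.adicCompletion L)]))
    (ϖ : (w.1.adicCompletion L)) (hϖ : Valued.v ϖ = WithZero.exp (-1 : ℤ))
    (g : ((cmDatum L 3 H').Local v) → ℂ)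
    (hginv : ∀ u ∈ (cmLocalIntegralLevel L 3 H' v), ∀ x, g (u * x * u⁻¹) = g x)
    (hg1 : ∀ u : ((cmDatum L 3 H').Local v),
      (∀ a b, Valued.v (((toPlace v w (HeckeCharacter.uniformizer ↥(maximalRealSubfield L) v : v.adicCompletion ↥(maximalRealSubfield L))) ^ 1)⁻¹ * (((((localNonsplitEquiv (IsCMField.complexConj L) H' (IsCMField.complexConj_ne_one L) w hw u) : ↥(unitaryGroupOfForm (galAdicCompletionMap (L := L) (IsCMField.complexConj L) hw) (placeForm H' w.1))) : GL (Fin 3) (w.1.adicCompletion L)) : Matrix (Fin 3) (Fin 3) (w.1.adicCompletion L)) a b - (1 : Matrix (Fin 3) (Fin 3) (w.1.adicCompletion L)) a b)) ≤ 1) →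
      ∀ x, g (u * x) = g x)
    (T : GL (Fin 3) (w.1.adicCompletion L)) (hT : T ∈ glInt 3 (w.1.adicCompletion L))
    (e : ↥(UnitaryGroup.«local» L (IsCMField.complexConj L) 3 H' v) ≃ₜ* ↥(unitaryGroupOfForm (galAdicCompletionMap (L := L) (IsCMField.complexConj L) hw) (placeForm (Matrix.of fun i j : Fin 3 => if i.val + j.val + 1 = 3 then (1 : L) else 0) w.1)))
    (hfr : ∀ z, ((e z).val : GL (Fin 3) (w.1.adicCompletion L)) = T * (((localNonsplitEquiv (IsCMField.complexConj L) H' (IsCMField.complexConj_ne_one L) w hw z)).val : GL (Fin 3) (w.1.adicCompletion L)) * T⁻¹)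
    (hKe : ∀ z, z ∈ cmLocalIntegralLevel L 3 H' v ↔ ((e z).val : GL (Fin 3) (w.1.adicCompletion L)) ∈ glInt 3 (w.1.adicCompletion L))
    {b₀ : (w.1.adicCompletion L)} (hb₀ : b₀ + (galAdicCompletionMap (L := L) (IsCMField.complexConj L) hw) b₀ + 1 = 0) (hb₀v : Valued.v b₀ ≤ 1)
    (uT : ((cmDatum L 3 H').Local v)) (huT : (((e uT).val : GL (Fin 3) (w.1.adicCompletion L)) : Matrix (Fin 3) (Fin 3) (w.1.adicCompletion L)) = !![1, 1, b₀; 0, 1, -1; 0, 0, 1])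
    {x : ((cmDatum L 3 H').Local v)} (hxK : x ∈ (cmLocalIntegralLevel L 3 H' v))
    (hrank : (redMat (((x).val : GL (Fin 3) (UnitaryGroup.LocalRing L v)).val.map (Pi.evalRingHom (fun w' : PlacesOver L v => w'.1.adicCompletion L) w)) - 1).rank = 2)
    {y : ((cmDatum L 3 H').Local v)} (hy : (∀ a b, Valued.v (((toPlace v w (HeckeCharacter.uniformizer ↥(maximalRealSubfield L) v : v.adicCompletion ↥(maximalRealSubfield L))) ^ 1)⁻¹ * (((((localNonsplitEquiv (IsCMField.complexConj L) H' (IsCMField.complexConj_ne_one L) w hw (y * x * y⁻¹)) : ↥(unitaryGroupOfForm (galAdicCompletionMap (L := L) (IsCMField.complexConj L) hw) (placeForm H' w.1))) : GL (Fin 3) (w.1.adicCompletion L)) : Matrix (Fin 3) (Fin 3) (w.1.adicCompletion L)) a b - (1 : Matrix (Fin 3) (Fin 3) (w.1.adicCompletion L)) a b)) ≤ 1)) :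
    g x = g uT := by
  classical
  have hc1 : IsCMField.complexConj L ≠ 1 := IsCMField.complexConj_ne_one L
  haveI : Algebra.IsQuadraticExtension ↥(maximalRealSubfield L) L := IsCMField.isQuadraticExtension L
  -- §0 the place `w`: `σ_w` an isometric involution, residually trivial; the block uniformiser `ϖ`; `|ι_v ϖ_v|_w = |ϖ|²`; `|2| = 1`
  have hσσ : ∀ z, (galAdicCompletionMap (L := L) (IsCMField.complexConj L) hw) ((galAdicCompletionMap (L := L) (IsCMField.complexConj L) hw) z) = z :=
    fun z => galAdicCompletionMap_galAdicCompletionMap_of_smul_eq (IsCMField.complexConj L) w hc1 hw z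
  have hvσ : ∀ a, Valued.v ((galAdicCompletionMap (L := L) (IsCMField.complexConj L) hw) a) = Valued.v a :=
    fun a => valued_galAdicCompletionMap (L := L) (IsCMField.complexConj L) hw a
  have hres : ∀ z : (w.1.adicCompletion L), Valued.v z ≤ 1 → Valued.v ((galAdicCompletionMap (L := L) (IsCMField.complexConj L) hw) z - z) < 1 :=
    fun z hz => valued_galAdicCompletionMap_sub_lt_one_of_ramified L (IsCMField.complexConj L) v hc1 w hw he z hz
  have h2v : Valued.v (2 : (w.1.adicCompletion L)) = 1 := (isUnit_two_integer_iff_valued_eq_one L w.1).1 h2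
  have hϖu : IsUniformizingElement ϖ := isUniformizingElement_of_v_eq hϖ
  have hϖ0 : ϖ ≠ 0 := fun h => by rw [h, map_zero] at hϖ; exact WithZero.coe_ne_zero hϖ.symm
  have hP : Valued.v (toPlace v w (HeckeCharacter.uniformizer ↥(maximalRealSubfield L) v : v.adicCompletion ↥(maximalRealSubfield L))) = WithZero.exp (-2 : ℤ) :=
    (valued_toPlace_uniformizer_of_ramified L (IsCMField.complexConj L) hc1 w hw he).1
  have hP1 : Valued.v ((toPlace v w (HeckeCharacter.uniformizer ↥(maximalRealSubfield L) v : v.adicCompletion ↥(maximalRealSubfield L))) ^ 1) = Valued.v (ϖ ^ 2) := by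
    rw [pow_one, hP, map_pow, hϖ, ← WithZero.exp_nsmul]; norm_num
  have hϖ20 : (ϖ ^ 2 : (w.1.adicCompletion L)) ≠ 0 := pow_ne_zero _ hϖ0
  have hP0 : (toPlace v w (HeckeCharacter.uniformizer ↥(maximalRealSubfield L) v : v.adicCompletion ↥(maximalRealSubfield L))) ^ 1 ≠ 0 := fun h => by
    rw [h, map_zero] at hP1; exact hϖ20 ((Valuation.zero_iff _).1 hP1.symm)
  -- §1 the frame: `placeForm Φ₃ w = J₀`, memberships, integrality of `T`
  have hJw : placeForm (Matrix.of fun i j : Fin 3 => if i.val + j.val + 1 = 3 then (1 : L) else 0) w.1 = ((StdForm.antidiagonal 3).over (w.1.adicCompletion L)) := by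
    rw [placeForm, antidiagOne_eq_over, StdForm.over_map]
  have hU : ∀ z, ((e z).val : GL (Fin 3) (w.1.adicCompletion L)) ∈ (unitaryGroupOfForm (galAdicCompletionMap (L := L) (IsCMField.complexConj L) hw) ((StdForm.antidiagonal 3).over (w.1.adicCompletion L))) := fun z => by
    rw [← hJw]; exact (e z).2
  have hTi : IsIntMatrix (T : Matrix (Fin 3) (Fin 3) (w.1.adicCompletion L)) := ((mem_glInt_iff_isIntMatrix L 3 w T).1 hT).1
  have hTi' : IsIntMatrix ((T⁻¹ : GL (Fin 3) (w.1.adicCompletion L)) : Matrix (Fin 3) (Fin 3) (w.1.adicCompletion L)) := ((mem_glInt_iff_isIntMatrix L 3 w T).1 hT).2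
  have hTT' : (T : Matrix (Fin 3) (Fin 3) (w.1.adicCompletion L)) * ((T⁻¹ : GL (Fin 3) (w.1.adicCompletion L)) : Matrix (Fin 3) (Fin 3) (w.1.adicCompletion L)) = 1 := by rw [← Units.val_mul, mul_inv_cancel, Units.val_one]
  have hT'T : ((T⁻¹ : GL (Fin 3) (w.1.adicCompletion L)) : Matrix (Fin 3) (Fin 3) (w.1.adicCompletion L)) * (T : Matrix (Fin 3) (Fin 3) (w.1.adicCompletion L)) = 1 := by rw [← Units.val_mul, inv_mul_cancel, Units.val_one]
  -- §2 opaque names for the images of `x`, `y`, `γ = y x y⁻¹` in the two models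
  obtain ⟨X₀, hX₀⟩ : ∃ X : GL (Fin 3) (w.1.adicCompletion L), X = (((localNonsplitEquiv (IsCMField.complexConj L) H' (IsCMField.complexConj_ne_one L) w hw x)).val : GL (Fin 3) (w.1.adicCompletion L)) := ⟨_, rfl⟩
  obtain ⟨Γ₀, hΓ₀⟩ : ∃ X : GL (Fin 3) (w.1.adicCompletion L), X = (((localNonsplitEquiv (IsCMField.complexConj L) H' (IsCMField.complexConj_ne_one L) w hw (y * x * y⁻¹))).val : GL (Fin 3) (w.1.adicCompletion L)) := ⟨_, rfl⟩
  obtain ⟨XR, hXR⟩ : ∃ X : GL (Fin 3) (w.1.adicCompletion L), X = ((e x).val : GL (Fin 3) (w.1.adicCompletion L)) := ⟨_, rfl⟩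
  obtain ⟨GR, hGR⟩ : ∃ X : GL (Fin 3) (w.1.adicCompletion L), X = ((e y).val : GL (Fin 3) (w.1.adicCompletion L)) := ⟨_, rfl⟩
  obtain ⟨ΓR, hΓR⟩ : ∃ X : GL (Fin 3) (w.1.adicCompletion L), X = ((e (y * x * y⁻¹)).val : GL (Fin 3) (w.1.adicCompletion L)) := ⟨_, rfl⟩
  have hXRT : XR = T * X₀ * T⁻¹ := by rw [hXR, hX₀]; exact hfr x
  have hΓRT : ΓR = T * Γ₀ * T⁻¹ := by rw [hΓR, hΓ₀]; exact hfr _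
  have he1 : e (y * x * y⁻¹) = e (y * x) * e y⁻¹ := map_mul e _ _
  have he2 : e (y * x) = e y * e x := map_mul e _ _
  have he3 : e y⁻¹ = (e y)⁻¹ := map_inv e _
  have hΓprod : ΓR = GR * XR * GR⁻¹ := by
    rw [hΓR, hGR, hXR, he1, he2, he3]; rfl
  have hΓU : ΓR ∈ (unitaryGroupOfForm (galAdicCompletionMap (L := L) (IsCMField.complexConj L) hw) ((StdForm.antidiagonal 3).over (w.1.adicCompletion L))) := by rw [hΓR]; exact hU _
  have hGU : GR ∈ (unitaryGroupOfForm (galAdicCompletionMap (L := L) (IsCMField.complexConj L) hw) ((StdForm.antidiagonal 3).over (w.1.adicCompletion L))) := by rw [hGR]; exact hU _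
  have hxg : XR = GR⁻¹ * ΓR * GR := by rw [hΓprod]; group
  -- §3 integrality of `e x`, the `v`-deep congruence of `e γ` in the block token `(ϖ ^ 2)⁻¹`
  have hxint : IsIntMatrix (XR : Matrix (Fin 3) (Fin 3) (w.1.adicCompletion L)) := by
    rw [hXR]; exact ((mem_glInt_iff_isIntMatrix L 3 w _).1 ((hKe x).1 hxK)).1
  have hX₀int : X₀ ∈ glInt 3 (w.1.adicCompletion L) := by
    rw [hX₀]; exact (mem_localIntegralLevel_iff_of_smul_eq (IsCMField.complexConj L) 3 H' hc1 w hw x).1 hxK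
  have hΓ₀1 : IsIntMatrix ((((toPlace v w (HeckeCharacter.uniformizer ↥(maximalRealSubfield L) v : v.adicCompletion ↥(maximalRealSubfield L))) ^ 1))⁻¹ • ((Γ₀ : Matrix (Fin 3) (Fin 3) (w.1.adicCompletion L)) - 1)) := by
    rw [hΓ₀]
    intro a b
    simpa only [Matrix.smul_apply, Matrix.sub_apply, smul_eq_mul] using hy a b
  have hΓ₀2 : IsIntMatrix ((ϖ ^ 2)⁻¹ • ((Γ₀ : Matrix (Fin 3) (Fin 3) (w.1.adicCompletion L)) - 1)) :=
    (isIntMatrix_inv_smul_iff_of_v_eq hP1 hP0 _).1 hΓ₀1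
  have hΓR2 : IsIntMatrix ((ϖ ^ 2)⁻¹ • ((ΓR : Matrix (Fin 3) (Fin 3) (w.1.adicCompletion L)) - 1)) := by
    have h := isIntMatrix_smul_conj_sub_one ((ϖ ^ 2)⁻¹) hTi hTi' hTT' hΓ₀2
    have hm : (ΓR : Matrix (Fin 3) (Fin 3) (w.1.adicCompletion L)) = (T : Matrix (Fin 3) (Fin 3) (w.1.adicCompletion L)) * (Γ₀ : Matrix (Fin 3) (Fin 3) (w.1.adicCompletion L)) * ((T⁻¹ : GL (Fin 3) (w.1.adicCompletion L)) : Matrix (Fin 3) (Fin 3) (w.1.adicCompletion L)) := by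
      rw [hΓRT]; simp only [Units.val_mul]
    rw [hm]; exact h
  -- §4 residual regularity read as depth `0`: `x_w ≢ 1 (mod ϖ)`, transported to `e x`
  have hMx : ((X₀ : GL (Fin 3) (w.1.adicCompletion L)) : Matrix (Fin 3) (Fin 3) (w.1.adicCompletion L)) = (((x).val : GL (Fin 3) (UnitaryGroup.LocalRing L v)).val.map (Pi.evalRingHom (fun w' : PlacesOver L v => w'.1.adicCompletion L) w)) := by
    rw [hX₀]; exact coe_localNonsplitEquiv_apply L H' v w hw x
  have hN0_of : IsIntMatrix (ϖ⁻¹ • (((X₀ : GL (Fin 3) (w.1.adicCompletion L)) : Matrix (Fin 3) (Fin 3) (w.1.adicCompletion L)) - 1)) →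
      (redMat ((X₀ : GL (Fin 3) (w.1.adicCompletion L)) : Matrix (Fin 3) (Fin 3) (w.1.adicCompletion L)) - 1).rank = 0 := fun hI => by
    have hle : ∀ i j, valuation (w.1.adicCompletion L) ((((X₀ : GL (Fin 3) (w.1.adicCompletion L)) : Matrix (Fin 3) (Fin 3) (w.1.adicCompletion L)) - 1) i j) ≤ valuation (w.1.adicCompletion L) ϖ := fun i j =>
      (v_le_iff_valuation_le _ _).1 ((UnitaryGroup.isIntMatrix_inv_smul_iff hϖ0 _).1 hI i j)
    exact (rank_redMat_sub_one_eq_zero_iff_forall_valuation_le hϖu hX₀int).2 hle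
  have hX₀m : ((X₀ : GL (Fin 3) (w.1.adicCompletion L)) : Matrix (Fin 3) (Fin 3) (w.1.adicCompletion L)) = ((T⁻¹ : GL (Fin 3) (w.1.adicCompletion L)) : Matrix (Fin 3) (Fin 3) (w.1.adicCompletion L)) * (XR : Matrix (Fin 3) (Fin 3) (w.1.adicCompletion L)) * (T : Matrix (Fin 3) (Fin 3) (w.1.adicCompletion L)) := by
    have h : X₀ = T⁻¹ * XR * T := by rw [hXRT]; group
    rw [h]; simp only [Units.val_mul]
  have hx0 : ¬ IsIntMatrix (ϖ⁻¹ • ((XR : Matrix (Fin 3) (Fin 3) (w.1.adicCompletion L)) - 1)) := fun hI => by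
    have hI₀ : IsIntMatrix (ϖ⁻¹ • (((X₀ : GL (Fin 3) (w.1.adicCompletion L)) : Matrix (Fin 3) (Fin 3) (w.1.adicCompletion L)) - 1)) := by
      rw [hX₀m]; exact isIntMatrix_smul_conj_sub_one ϖ⁻¹ hTi' hTi hT'T hI
    have h0 := hN0_of hI₀
    rw [hMx, hrank] at h0
    exact two_ne_zero h0
  -- §5 RIGID-2-ram in unit-factor form, pulled back along the frame at the `v`-level-1 token
  obtain ⟨k, m, u, hkU, hki, hki', hm, -, -, -, huU, hu2, hkxk⟩ :=
    exists_conj_eq_levelTwo_mul_upperUnipotent_one_of_ramified hσσ hvσ hϖ hres h2v hΓU hΓR2 hGU hxg hxint hx0 hb₀ hb₀v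
  have hu1 : IsIntMatrix ((((toPlace v w (HeckeCharacter.uniformizer ↥(maximalRealSubfield L) v : v.adicCompletion ↥(maximalRealSubfield L))) ^ 1))⁻¹ • ((u : Matrix (Fin 3) (Fin 3) (w.1.adicCompletion L)) - 1)) :=
    (isIntMatrix_inv_smul_iff_of_v_eq hP1 hP0 _).2 hu2
  exact apply_eq_of_conj_eq_level_mul L H' w hw (((toPlace v w (HeckeCharacter.uniformizer ↥(maximalRealSubfield L) v : v.adicCompletion ↥(maximalRealSubfield L))) ^ 1)⁻¹) g hginv hg1 T hT e hfr hKe hkU hki hki' huU hu1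
    (by rw [← hXR, ← (Units.ext (by rw [hm, huT]) : m = ((e uT).val : GL (Fin 3) (w.1.adicCompletion L)))]; exact hkxk)

end Heart

/-! ## §4 Row (R1) of the two-layer head: the boundary value in the fold's tokens -/

section RowOne

set_option maxHeartbeats 800000 in
-- budget only: one statement-heavy declaration (the fold's :118 tokens); no search tactic runs long here.
/-- **ROW (R1) OF THE TWO-LAYER (U)-ram HEAD — the boundary value of a `v`-level-1 `K`-class piece at a tame-ramified place.**  Binders = the piece group of the fold's
`stub_levelOneRowsRam` :118 (`LocalTransferAtOneTameRamified` v6) VERBATIM: `(hH' w hw he hH'w hH'i h2)`, block `(ϖ hϖ hσϖ)` (`hσϖ` idle here, kept for the common binder list),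
frame `(A hA hframe)`, piece `(g hginv hg1)`.  CONCLUSION (hypotheses as ONE conjunction, the inert organ-V ∕ (O2″) `hc` convention = F0P3-p02 (g16)'s L4 `hc` text): there is `c : ℕ → ℂ` with `c 0 = 0` such that `g x = c 2` for
every `x ∈ K` with `(red x_w − 1)³ = 0`, `rank(red x_w − 1) = 2` that is `G′_v`-conjugate into `K(ϖ_v)` (`∃ y, y x y⁻¹ ≡ 1 (mod ϖ_v)`, token `(toPlace v w ϖ_v) ^ 1`).  The rank-`1` row is EMPTY at a ramified place (★ p846855∕p846826), the rank-`0`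
row is the interior (FILE C).  Proof: the frame of ★ p846897 from `hframe`, `b₀ := −2⁻¹`, `c 2 := g (e⁻¹ u(1,1,b₀))`, §3.
[cite: Rogawski1990, §3.9 p. 32, Prop. 3.9.1; §4.9 p. 54] [cite: Tits1979, §3.5] [cite: Kottwitz1986, §3] -/
theorem exists_boundaryValue_of_levelOne_ramified
    (L : Type) [Field L] [NumberField L] [IsCMField L] (H' : Matrix (Fin 3) (Fin 3) L)
    {v : HeightOneSpectrum (𝓞 ↥(maximalRealSubfield L))}
    (_hH' : (H'.map (cmConjRingHom L)).transpose = H') (w : PlacesOver L v)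
    (hw : IsCMField.complexConj L • w.1 = w.1) (he : v.asIdeal.ramificationIdx' w.1.asIdeal ≠ 1)
    (hH'w : IsUnit (placeForm H' w.1)) (_hH'i : hH'w.unit ∈ glInt 3 (w.1.adicCompletion L))
    (h2 : IsUnit (2 : 𝒪[(w.1.adicCompletion L)]))
    (ϖ : (w.1.adicCompletion L)) (hϖ : Valued.v ϖ = WithZero.exp (-1 : ℤ)) (_hσϖ : galAdicCompletionMap (L := L) (IsCMField.complexConj L) hw ϖ = -ϖ)
    (A : GL (Fin 3) (w.1.adicCompletion L)) (hA : A ∈ glInt 3 (w.1.adicCompletion L))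
    (hframe : placeForm H' w.1 = (-(placeForm H' w.1).det) • formCongr (galAdicCompletionMap (L := L) (IsCMField.complexConj L) hw) A ((StdForm.antidiagonal 3).over (w.1.adicCompletion L)))
    (g : ((cmDatum L 3 H').Local v) → ℂ)
    (hginv : ∀ u ∈ cmLocalIntegralLevel L 3 H' v, ∀ x, g (u * x * u⁻¹) = g x)
    (hg1 : ∀ u : ((cmDatum L 3 H').Local v),
      (∀ a b, Valued.v (((toPlace v w (HeckeCharacter.uniformizer ↥(maximalRealSubfield L) v : v.adicCompletion ↥(maximalRealSubfield L))) ^ 1)⁻¹ *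
        ((((localNonsplitEquiv (IsCMField.complexConj L) H' (IsCMField.complexConj_ne_one L) w hw u :
            ↥(unitaryGroupOfForm (galAdicCompletionMap (L := L) (IsCMField.complexConj L) hw) (placeForm H' w.1))) : GL (Fin 3) (w.1.adicCompletion L)) :
              Matrix (Fin 3) (Fin 3) (w.1.adicCompletion L)) a b - (1 : Matrix (Fin 3) (Fin 3) (w.1.adicCompletion L)) a b)) ≤ 1) →
      ∀ x, g (u * x) = g x) :
    ∃ c : ℕ → ℂ, c 0 = 0 ∧
      (∀ x : ((cmDatum L 3 H').Local v), (x ∈ cmLocalIntegralLevel L 3 H' v ∧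
        (redMat (((x).val : GL (Fin 3) (UnitaryGroup.LocalRing L v)).val.map (Pi.evalRingHom (fun w' : PlacesOver L v => w'.1.adicCompletion L) w)) - 1) ^ 3 = 0 ∧
        (redMat (((x).val : GL (Fin 3) (UnitaryGroup.LocalRing L v)).val.map (Pi.evalRingHom (fun w' : PlacesOver L v => w'.1.adicCompletion L) w)) - 1).rank = 2 ∧
        ∃ y : ((cmDatum L 3 H').Local v), (∀ a b, Valued.v (((toPlace v w (HeckeCharacter.uniformizer ↥(maximalRealSubfield L) v : v.adicCompletion ↥(maximalRealSubfield L))) ^ 1)⁻¹ *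
          ((((localNonsplitEquiv (IsCMField.complexConj L) H' (IsCMField.complexConj_ne_one L) w hw (y * x * y⁻¹) :
            ↥(unitaryGroupOfForm (galAdicCompletionMap (L := L) (IsCMField.complexConj L) hw) (placeForm H' w.1))) : GL (Fin 3) (w.1.adicCompletion L)) :
              Matrix (Fin 3) (Fin 3) (w.1.adicCompletion L)) a b - (1 : Matrix (Fin 3) (Fin 3) (w.1.adicCompletion L)) a b)) ≤ 1)) →
        g x = c 2) := by
  classical
  have hc1 : IsCMField.complexConj L ≠ 1 := IsCMField.complexConj_ne_one L
  -- the frame from the binder `hframe` (★ p846897), `T := A`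
  obtain ⟨e, hfr, hKe, -⟩ := exists_frame_of_eq_smul_formCongr_antidiagonal L H' w hw hH'w A hA hframe
  have hJw : placeForm (Matrix.of fun i j : Fin 3 => if i.val + j.val + 1 = 3 then (1 : L) else 0) w.1 = ((StdForm.antidiagonal 3).over (w.1.adicCompletion L)) := by
    rw [placeForm, antidiagOne_eq_over, StdForm.over_map]
  have hσσ : ∀ z, (galAdicCompletionMap (L := L) (IsCMField.complexConj L) hw) ((galAdicCompletionMap (L := L) (IsCMField.complexConj L) hw) z) = z :=
    fun z => galAdicCompletionMap_galAdicCompletionMap_of_smul_eq (IsCMField.complexConj L) w hc1 hw z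
  -- the reference `u(1, 1, b₀)`, `b₀ := −2⁻¹`
  have h2v : Valued.v (2 : (w.1.adicCompletion L)) = 1 := (isUnit_two_integer_iff_valued_eq_one L w.1).1 h2
  have h20 : (2 : (w.1.adicCompletion L)) ≠ 0 := fun h => by rw [h, map_zero] at h2v; exact zero_ne_one h2v
  have hb₀ : (-(2 : (w.1.adicCompletion L))⁻¹) + (galAdicCompletionMap (L := L) (IsCMField.complexConj L) hw) (-(2 : (w.1.adicCompletion L))⁻¹) + 1 = 0 := by
    rw [map_neg, map_inv₀, map_ofNat]
    field_simp
    norm_num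
  have hb₀v : Valued.v (-(2 : (w.1.adicCompletion L))⁻¹) ≤ 1 := by
    rw [Valuation.map_neg, map_inv₀, h2v, inv_one]
  obtain ⟨m, hm, -⟩ := exists_units_coe_eq_upperTriangularUnipotent (1 : (w.1.adicCompletion L)) (-(2 : (w.1.adicCompletion L))⁻¹) (-1)
  have hmU : m ∈ (unitaryGroupOfForm (galAdicCompletionMap (L := L) (IsCMField.complexConj L) hw) ((StdForm.antidiagonal 3).over (w.1.adicCompletion L))) := by
    refine (mem_unitaryGroupOfForm_iff_of_coe_eq_upperUnipotent (galAdicCompletionMap (L := L) (IsCMField.complexConj L) hw) hσσ hm).2 ⟨by rw [map_one], ?_⟩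
    rw [map_one, mul_one]; exact hb₀
  have hmU' : m ∈ (unitaryGroupOfForm (galAdicCompletionMap (L := L) (IsCMField.complexConj L) hw) (placeForm (Matrix.of fun i j : Fin 3 => if i.val + j.val + 1 = 3 then (1 : L) else 0) w.1)) := by rw [hJw]; exact hmU
  obtain ⟨uT, huT⟩ : ∃ z : ((cmDatum L 3 H').Local v), z = e.symm ⟨m, hmU'⟩ := ⟨_, rfl⟩
  have heuT : (((e uT).val : GL (Fin 3) (w.1.adicCompletion L)) : Matrix (Fin 3) (Fin 3) (w.1.adicCompletion L)) = !![1, 1, -(2 : (w.1.adicCompletion L))⁻¹; 0, 1, -1; 0, 0, 1] := by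
    rw [huT, e.apply_symm_apply]; exact hm
  refine ⟨fun s => if s = 2 then g uT else 0, by simp, ?_⟩
  rintro x ⟨hxK, -, hr, y, hy⟩
  have h := apply_eq_of_levelDeep_of_rank_redMat_sub_one_eq_two_ramified L H' w hw he h2 ϖ hϖ g hginv hg1 A hA e hfr hKe hb₀ hb₀v uT heuT hxK hr hy
  simpa using h

end RowOne

end Literature.NumberTheory.Rogawski1990

end
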